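import Summits.Ventures.LatticeQCDFlow.Exactness.FlowSamplerSquareIntegrableSticking
import Summits.Ventures.LatticeQCDFlow.Exactness.Phi4FlowSquareIntegrable
import HarnessLib

/-!
# Row 2's FLOW ARM: every lag of every polynomial observable of lattice φ⁴ — the magnetisation included — is floored by the sticking moments, `ρ_f(k+1) ≥ E_{g²}[r^{k+1}]/E[g²]`

HONEST FRAMING: exact (Metropolis-corrected) sampling algorithms for lattice gauge theory;
figures of merit are autocorrelation/cost numbers at stated couplings and volumes; no
continuum-physics claim.  (SCALAR calibration rung S0-A: not a gauge result.)

Venture `LatticeQCDFlow` (cell pub-lqcd), topic `Exactness`; FANOUT row 2 (`s0-phi4`, FLOW arm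
`K = imhOpPhi4 J λ q̃`, every `λ > 0`, real `J`, EVERY positive measurable model density with
`∫ q̃ = 1` — no weight bound, no moment hypothesis on the flow).  NEW WORK of the cell: the lattice
instances of `FlowSamplerSquareIntegrableSticking` (`imhOp_autocov_ge_sticking_of_sq`,
`imhOp_autocorr_ge_sticking_of_sq`, `imhOp_tauInt_ge_stickingSum_of_sq`) on the class `PolyObs`
(`Phi4FlowSquareIntegrable`: `PolyObs ⊆ L²(e^{−S})`), and the SUMMED sticking floor
`τ_int ≥ ½ + E_{g²}[r/(1 − r)]/E[g²]` on `L²(e^{−S})` (the bounded-class proof of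
`IMHStickingFloorSummed` — monotone convergence over the all-lag floors — run verbatim on the
square-integrable class).  The bounded-observable lattice theorems `phi4Flow_autocov_ge_sticking` /
`phi4Flow_autocorr_ge_sticking` / `phi4Flow_tauInt_ge_stickingOdds` stand.  Nothing is cited as a
fact.

## What is proved

General space (`w, q > 0` measurable integrable, `∫ q = 1`; `g` measurable, `∫ g² w < ∞`; `r` the
rejection probability): **`imhOp_tauInt_ge_stickingSummed_of_sq`** — summable series ⇒
`½ + (∫ g² w r/(1 − r))/(∫ g² w) ≤ τ_int(g)`.

Lattice (`Λ = Fin (n+1)`, `λ > 0`, `g = f − ⟨f⟩`,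
`r(φ) = ∫ (1 − α(φ,φ')) q̃(φ') dφ'` the rejection probability of the flow proposal from `φ`):

* **`phi4Flow_autocov_ge_sticking_poly`** — `f ∈ PolyObs`, every lag `k`:
  `∫ g² e^{−S} r^{k+1} ≤ ∫ g (K^{k+1} g) e^{−S}`;
* **`phi4Flow_autocorr_ge_sticking_poly`** — the normalised form `ρ_f(k+1) ≥ E_{g²}[r^{k+1}]/E[g²]`;
* **`phi4Flow_tauInt_ge_stickingSum_poly`** — summable series ⇒ for every `N`,
  `½ + Σ_{k<N} E_{g²}[r^{k+1}]/E[g²] ≤ τ_int(f)`;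
* **`phi4Flow_autocorr_ge_sticking_magnetisation`** — THE MAGNETISATION `M = Σ_x φ_x` ITSELF: for
  every lag, `ρ_M(k+1) ≥ E_{M̃²}[r^{k+1}]/Var M` (`Var M` unnormalised: `∫ M̃² e^{−S}`);
* **`phi4Flow_tauInt_ge_stickingSummed_poly`** / **`…_magnetisation`** — summable series ⇒
  `τ_int(f) ≥ ½ + E_{g²}[r/(1 − r)]/E[g²]`, in particular `τ_int(M) ≥ ½ + E_{M̃²}[r/(1 − r)]/Var M`.

Reading for S0-A (no numerics implied): with `Phi4FlowSquareIntegrable` (`ρ_M(1) ≥ r̄_M`,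
log-convexity `ρ_M(k) ≥ ρ_M(1)ᵏ`) the flow arm's magnetisation autocorrelation at lag `k` is at least
`max(r̄_Mᵏ, E_{M̃²}[rᵏ]/Var M)` and the second is never smaller (Jensen) — configurations where the
model under-weights the target (`r` near `1`) floor every lag, whatever the network.
NOT CLAIMED: any value of `r` for any run or trained network; anything for the HMC / local arms.
-/

namespace Summit.Ventures.LatticeQCDFlow.Exactness

open Real MeasureTheory Filter Finset Set Topology
open Summit.Ventures.LatticeQCDFlow.Scoring

/-! ## §1 The summed sticking floor on `L²(w)` (general space) -/

section General

variable {X : Type*} [MeasurableSpace X] {μ : Measure X} [SFinite μ] {w q : X → ℝ}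

/-- **THE SUMMED STICKING FLOOR FOR EVERY SQUARE-INTEGRABLE OBSERVABLE.**  `w, q > 0` measurable
integrable, `∫ q = 1`; `g` measurable with `∫ g² w < ∞`; `r(x)` the rejection probability from `x`.
If the autocorrelation series of `g` along the exact chain is summable, then
`½ + (∫ g² w · r/(1 − r) dμ) / (∫ g² w dμ) ≤ τ_int(g)`
— the all-lag floors of `FlowSamplerSquareIntegrableSticking` summed by monotone convergence (the
bounded-class proof of `IMHStickingFloorSummed` verbatim on `L²(w)`; where `r = 1`, Lean's `1/0 = 0`
makes the integrand vanish).  By Jensen (`x ↦ x/(1 − x)` convex) this dominates the first-moment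
odds floor `½ + r̄/(1 − r̄)` of `FlowSamplerSquareIntegrableMonotone`. -/
theorem imhOp_tauInt_ge_stickingSummed_of_sq (hw0 : ∀ t, 0 < w t) (hwm : Measurable w)
    (hwi : Integrable w μ) (hq0 : ∀ t, 0 < q t) (hqm : Measurable q) (hqi : Integrable q μ)
    (hq1 : ∫ z, q z ∂μ = 1) {g : X → ℝ} (hgm : Measurable g)
    (hg2 : Integrable (fun t => g t ^ 2 * w t) μ)
    (hs : Summable fun n => (∫ x, g x * ((imhOp μ w q)^[n + 1] g) x * w x ∂μ)
      / ∫ x, g x ^ 2 * w x ∂μ) :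
    1 / 2 + (∫ x, g x ^ 2 * w x * ((∫ z, (1 - imhAcceptQ w q x z) * q z ∂μ)
        / (1 - ∫ z, (1 - imhAcceptQ w q x z) * q z ∂μ)) ∂μ) / ∫ x, g x ^ 2 * w x ∂μ
      ≤ tauInt (fun n => (∫ x, g x * ((imhOp μ w q)^[n] g) x * w x ∂μ) / ∫ x, g x ^ 2 * w x ∂μ) := by
  obtain ⟨hr0, hr1, hrm⟩ := rejection_bounds (μ := μ) hw0 hwm hq0 hqm hqi hq1
  set r : X → ℝ := fun x => ∫ z, (1 - imhAcceptQ w q x z) * q z ∂μ with hr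
  have hr0' : ∀ x, 0 ≤ r x := hr0
  have hr1' : ∀ x, r x ≤ 1 := hr1
  set A := ∫ x, g x ^ 2 * w x ∂μ with hA
  set τ := tauInt (fun n => (∫ x, g x * ((imhOp μ w q)^[n] g) x * w x ∂μ) / A) with hτ
  have hA0 : 0 ≤ A := integral_nonneg fun x => mul_nonneg (sq_nonneg _) (hw0 x).le
  -- partial sums: `∫ g² w Σ_{n<N} r^{n+1} ≤ A (τ − ½)`
  have hpart := imhOp_tauInt_ge_stickingSum_of_sq hw0 hwm hwi hq0 hqm hqi hq1 hgm hg2 hs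
  set f : ℕ → X → ℝ := fun N x => g x ^ 2 * w x * ∑ n ∈ Finset.range N, r x ^ (n + 1) with hf
  have hterm_le : ∀ n x, g x ^ 2 * w x * r x ^ (n + 1) ≤ g x ^ 2 * w x := fun n x =>
    mul_le_of_le_one_right (mul_nonneg (sq_nonneg _) (hw0 x).le) (pow_le_one₀ (hr0' x) (hr1' x))
  have hterm_nn : ∀ n x, 0 ≤ g x ^ 2 * w x * r x ^ (n + 1) := fun n x =>
    mul_nonneg (mul_nonneg (sq_nonneg _) (hw0 x).le) (pow_nonneg (hr0' x) _)
  have hterm_int : ∀ n, Integrable (fun x => g x ^ 2 * w x * r x ^ (n + 1)) μ := by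
    intro n
    refine Integrable.mono' hg2 (((hgm.pow_const 2).mul hwm).mul
      (hrm.pow_const _)).aestronglyMeasurable (Eventually.of_forall fun x => ?_)
    rw [Real.norm_eq_abs, abs_of_nonneg (hterm_nn n x)]
    exact hterm_le n x
  have hf_int : ∀ N, Integrable (f N) μ := by
    intro N
    have e : f N = fun x => ∑ n ∈ Finset.range N, g x ^ 2 * w x * r x ^ (n + 1) := by
      funext x
      simp only [hf, Finset.mul_sum]
    rw [e]
    exact integrable_finsetSum _ fun n _ => hterm_int n
  have hf_nonneg : ∀ N x, 0 ≤ f N x := fun N x =>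
    mul_nonneg (mul_nonneg (sq_nonneg _) (hw0 x).le) (Finset.sum_nonneg fun n _ => pow_nonneg (hr0' x) _)
  have hf_mono : ∀ x, Monotone fun N => f N x := by
    intro x N N' hNN'
    simp only [hf]
    refine mul_le_mul_of_nonneg_left ?_ (mul_nonneg (sq_nonneg _) (hw0 x).le)
    exact Finset.sum_le_sum_of_subset_of_nonneg (Finset.range_mono hNN') fun n _ _ => pow_nonneg (hr0' x) _
  have hf_meas : ∀ N, Measurable (f N) := fun N =>
    ((hgm.pow_const 2).mul hwm).mul (Finset.measurable_sum _ fun n _ => hrm.pow_const _)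
  have hf_le : ∀ N, ∫ x, f N x ∂μ ≤ A * (τ - 1 / 2) := by
    intro N
    have h := hpart N
    have e : ∫ x, f N x ∂μ = ∑ n ∈ Finset.range N, ∫ x, g x ^ 2 * w x * r x ^ (n + 1) ∂μ := by
      rw [← integral_finsetSum _ fun n _ => hterm_int n]
      refine integral_congr_ae (Eventually.of_forall fun x => ?_)
      simp only [hf, Finset.mul_sum]
    rw [e]
    rcases eq_or_lt_of_le hA0 with hz | hpos
    · have hle : ∀ n, ∫ x, g x ^ 2 * w x * r x ^ (n + 1) ∂μ ≤ A := fun n =>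
        integral_mono (hterm_int n) hg2 fun x => hterm_le n x
      have h0 : ∀ n, 0 ≤ ∫ x, g x ^ 2 * w x * r x ^ (n + 1) ∂μ := fun n =>
        integral_nonneg fun x => hterm_nn n x
      have hsum0 : ∑ n ∈ Finset.range N, ∫ x, g x ^ 2 * w x * r x ^ (n + 1) ∂μ = 0 :=
        Finset.sum_eq_zero fun n _ => le_antisymm ((hle n).trans hz.symm.le) (h0 n)
      rw [hsum0, ← hz, zero_mul]
    · have h' : ∑ n ∈ Finset.range N, (∫ x, g x ^ 2 * w x * r x ^ (n + 1) ∂μ) / A ≤ τ - 1 / 2 := by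
        linarith
      rw [← Finset.sum_div, div_le_iff₀ hpos] at h'
      linarith
  -- the summed integrand is dominated pointwise by `⨆_N f_N` (in `ℝ≥0∞`)
  have hptw : ∀ x, ENNReal.ofReal (g x ^ 2 * w x * (r x / (1 - r x)))
      ≤ ⨆ N, ENNReal.ofReal (f N x) := by
    intro x
    rcases eq_or_lt_of_le (hr1' x) with h1 | hlt
    · rw [h1, sub_self, div_zero, mul_zero, ENNReal.ofReal_zero]
      exact bot_le
    · have habs : |r x| < 1 := by rw [abs_of_nonneg (hr0' x)]; exact hlt
      have hlim : Tendsto (fun N => f N x) atTop (𝓝 (g x ^ 2 * w x * (r x / (1 - r x)))) := by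
        simp only [hf]
        exact ((hasSum_geometric_succ habs).tendsto_sum_nat).const_mul _
      have hlim' := ENNReal.tendsto_ofReal hlim
      have hsup : Tendsto (fun N => ENNReal.ofReal (f N x)) atTop (𝓝 (⨆ N, ENNReal.ofReal (f N x))) :=
        tendsto_atTop_iSup fun N N' h => ENNReal.ofReal_le_ofReal (hf_mono x h)
      exact (tendsto_nhds_unique hlim' hsup).le
  -- monotone convergence
  have hL : ∫⁻ x, ENNReal.ofReal (g x ^ 2 * w x * (r x / (1 - r x))) ∂μ
      ≤ ENNReal.ofReal (A * (τ - 1 / 2)) := by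
    calc ∫⁻ x, ENNReal.ofReal (g x ^ 2 * w x * (r x / (1 - r x))) ∂μ
        ≤ ∫⁻ x, ⨆ N, ENNReal.ofReal (f N x) ∂μ := lintegral_mono fun x => hptw x
      _ = ⨆ N, ∫⁻ x, ENNReal.ofReal (f N x) ∂μ :=
          lintegral_iSup (fun N => (hf_meas N).ennreal_ofReal)
            (fun N N' h x => ENNReal.ofReal_le_ofReal (hf_mono x h))
      _ = ⨆ N, ENNReal.ofReal (∫ x, f N x ∂μ) := by
          congr 1
          funext N
          rw [ofReal_integral_eq_lintegral_ofReal (hf_int N) (Eventually.of_forall (hf_nonneg N))]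
      _ ≤ ENNReal.ofReal (A * (τ - 1 / 2)) := iSup_le fun N => ENNReal.ofReal_le_ofReal (hf_le N)
  have hI : ∫ x, g x ^ 2 * w x * (r x / (1 - r x)) ∂μ ≤ A * (τ - 1 / 2) := by
    have hnn : 0 ≤ᵐ[μ] fun x => g x ^ 2 * w x * (r x / (1 - r x)) :=
      Eventually.of_forall fun x => mul_nonneg (mul_nonneg (sq_nonneg _) (hw0 x).le)
        (div_nonneg (hr0' x) (sub_nonneg.2 (hr1' x)))
    rw [integral_eq_lintegral_of_nonneg_ae hnn ((((hgm.pow_const 2).mul hwm).mul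
      (hrm.div (measurable_const.sub hrm))).aestronglyMeasurable)]
    have hAτ : 0 ≤ A * (τ - 1 / 2) := by
      have h := hf_le 0
      have e : ∫ x, f 0 x ∂μ = 0 := by simp [hf]
      linarith
    exact ENNReal.toReal_le_of_le_ofReal hAτ hL
  -- conclude
  rcases eq_or_lt_of_le hA0 with hz | hpos
  · rw [← hz, div_zero, add_zero]
    have h := hpart 0
    simp only [Finset.range_zero, Finset.sum_empty, add_zero] at h
    exact h
  · rw [← sub_nonneg]
    have : (∫ x, g x ^ 2 * w x * (r x / (1 - r x)) ∂μ) / A ≤ τ - 1 / 2 := by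
      rw [div_le_iff₀ hpos]
      linarith
    linarith

end General

/-! ## §2 The lattice -/

section Lattice

variable {n : ℕ}

/-- **ALL-LAG STICKING FLOOR FOR EVERY POLYNOMIAL OBSERVABLE OF LATTICE φ⁴ UNDER THE FLOW ARM.**
Every `λ > 0`, real `J`, positive measurable model density with `∫ q̃ = 1`; `f ∈ PolyObs`,
`g = f − ⟨f⟩`.  For every lag `k`:  `∫ g² e^{−S} r^{k+1} dφ ≤ ∫ g (K^{k+1} g) e^{−S} dφ`. -/
theorem phi4Flow_autocov_ge_sticking_poly {lam : ℝ} (hlam : 0 < lam)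
    (J : Fin (n + 1) → Fin (n + 1) → ℝ) {q : (Fin (n + 1) → ℝ) → ℝ} (hq0 : ∀ φ, 0 < q φ)
    (hqm : Measurable q) (hqi : Integrable q) (hq1 : ∫ φ, q φ = 1) {f : (Fin (n + 1) → ℝ) → ℝ}
    (hf : PolyObs f) (k : ℕ) :
    ∫ φ, (f φ - gibbsExpect J lam f) ^ 2 * gibbsWeight J lam φ
        * (∫ φ', (1 - imhAcceptQ (gibbsWeight J lam) q φ φ') * q φ') ^ (k + 1)
      ≤ ∫ φ, (f φ - gibbsExpect J lam f)
        * ((imhOpPhi4 J lam q)^[k + 1] (fun ψ => f ψ - gibbsExpect J lam f)) φ * gibbsWeight J lam φ := by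
  obtain ⟨hgm, hg2⟩ := polyObs_sq_integrable hlam J (polyObs_sub_const hf (gibbsExpect J lam f))
  rw [imhOpPhi4_eq_imhOp]
  exact imhOp_autocov_ge_sticking_of_sq (μ := volume) (fun φ => gibbsWeight_pos J lam φ)
    (continuous_gibbsWeight J lam).measurable (integrable_gibbsWeight hlam J) hq0 hqm hqi hq1 k hgm hg2

/-- **`ρ_f(k+1) ≥ E_{g²}[r^{k+1}]/E[g²]`** for every `f ∈ PolyObs` and every lag (normalised form). -/
theorem phi4Flow_autocorr_ge_sticking_poly {lam : ℝ} (hlam : 0 < lam)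
    (J : Fin (n + 1) → Fin (n + 1) → ℝ) {q : (Fin (n + 1) → ℝ) → ℝ} (hq0 : ∀ φ, 0 < q φ)
    (hqm : Measurable q) (hqi : Integrable q) (hq1 : ∫ φ, q φ = 1) {f : (Fin (n + 1) → ℝ) → ℝ}
    (hf : PolyObs f) (k : ℕ) :
    (∫ φ, (f φ - gibbsExpect J lam f) ^ 2 * gibbsWeight J lam φ
        * (∫ φ', (1 - imhAcceptQ (gibbsWeight J lam) q φ φ') * q φ') ^ (k + 1))
        / ∫ φ, (f φ - gibbsExpect J lam f) ^ 2 * gibbsWeight J lam φ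
      ≤ (∫ φ, (f φ - gibbsExpect J lam f)
          * ((imhOpPhi4 J lam q)^[k + 1] (fun ψ => f ψ - gibbsExpect J lam f)) φ * gibbsWeight J lam φ)
        / ∫ φ, (f φ - gibbsExpect J lam f) ^ 2 * gibbsWeight J lam φ := by
  obtain ⟨hgm, hg2⟩ := polyObs_sq_integrable hlam J (polyObs_sub_const hf (gibbsExpect J lam f))
  rw [imhOpPhi4_eq_imhOp]
  exact imhOp_autocorr_ge_sticking_of_sq (μ := volume) (fun φ => gibbsWeight_pos J lam φ)
    (continuous_gibbsWeight J lam).measurable (integrable_gibbsWeight hlam J) hq0 hqm hqi hq1 k hgm hg2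

/-- **Partial-sum sticking floor on `τ_int` for every `f ∈ PolyObs`**: if the autocorrelation series of
`f` under the flow arm is summable, then for every `N`:
`½ + Σ_{k<N} E_{g²}[r^{k+1}]/E[g²] ≤ τ_int(f)`. -/
theorem phi4Flow_tauInt_ge_stickingSum_poly {lam : ℝ} (hlam : 0 < lam)
    (J : Fin (n + 1) → Fin (n + 1) → ℝ) {q : (Fin (n + 1) → ℝ) → ℝ} (hq0 : ∀ φ, 0 < q φ)
    (hqm : Measurable q) (hqi : Integrable q) (hq1 : ∫ φ, q φ = 1) {f : (Fin (n + 1) → ℝ) → ℝ}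
    (hf : PolyObs f)
    (hs : Summable fun k => (∫ φ, (f φ - gibbsExpect J lam f)
        * ((imhOpPhi4 J lam q)^[k + 1] (fun ψ => f ψ - gibbsExpect J lam f)) φ * gibbsWeight J lam φ)
        / ∫ φ, (f φ - gibbsExpect J lam f) ^ 2 * gibbsWeight J lam φ) (N : ℕ) :
    1 / 2 + ∑ k ∈ Finset.range N,
        (∫ φ, (f φ - gibbsExpect J lam f) ^ 2 * gibbsWeight J lam φ
          * (∫ φ', (1 - imhAcceptQ (gibbsWeight J lam) q φ φ') * q φ') ^ (k + 1))
          / ∫ φ, (f φ - gibbsExpect J lam f) ^ 2 * gibbsWeight J lam φ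
      ≤ tauInt (fun k => (∫ φ, (f φ - gibbsExpect J lam f)
          * ((imhOpPhi4 J lam q)^[k] (fun ψ => f ψ - gibbsExpect J lam f)) φ * gibbsWeight J lam φ)
          / ∫ φ, (f φ - gibbsExpect J lam f) ^ 2 * gibbsWeight J lam φ) := by
  obtain ⟨hgm, hg2⟩ := polyObs_sq_integrable hlam J (polyObs_sub_const hf (gibbsExpect J lam f))
  rw [imhOpPhi4_eq_imhOp] at hs ⊢
  exact imhOp_tauInt_ge_stickingSum_of_sq (μ := volume) (fun φ => gibbsWeight_pos J lam φ)
    (continuous_gibbsWeight J lam).measurable (integrable_gibbsWeight hlam J) hq0 hqm hqi hq1 hgm hg2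
    hs N

/-- **EVERY LAG OF THE MAGNETISATION IS FLOORED BY THE STICKING MOMENTS**: `M = Σ_x φ_x`,
`M̃ = M − ⟨M⟩`; for every positive model density and every lag `k`:
`ρ_M(k+1) = (∫ M̃ (K^{k+1} M̃) e^{−S}) / ∫ M̃² e^{−S} ≥ (∫ M̃² e^{−S} r^{k+1}) / ∫ M̃² e^{−S}`. -/
theorem phi4Flow_autocorr_ge_sticking_magnetisation {lam : ℝ} (hlam : 0 < lam)
    (J : Fin (n + 1) → Fin (n + 1) → ℝ) {q : (Fin (n + 1) → ℝ) → ℝ} (hq0 : ∀ φ, 0 < q φ)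
    (hqm : Measurable q) (hqi : Integrable q) (hq1 : ∫ φ, q φ = 1) (k : ℕ) :
    (∫ φ, ((∑ x, φ x) - gibbsExpect J lam (fun ψ => ∑ x, ψ x)) ^ 2 * gibbsWeight J lam φ
        * (∫ φ', (1 - imhAcceptQ (gibbsWeight J lam) q φ φ') * q φ') ^ (k + 1))
        / ∫ φ, ((∑ x, φ x) - gibbsExpect J lam (fun ψ => ∑ x, ψ x)) ^ 2 * gibbsWeight J lam φ
      ≤ (∫ φ, ((∑ x, φ x) - gibbsExpect J lam (fun ψ => ∑ x, ψ x))
          * ((imhOpPhi4 J lam q)^[k + 1]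
              (fun ψ => (∑ x, ψ x) - gibbsExpect J lam (fun ψ => ∑ x, ψ x))) φ * gibbsWeight J lam φ)
        / ∫ φ, ((∑ x, φ x) - gibbsExpect J lam (fun ψ => ∑ x, ψ x)) ^ 2 * gibbsWeight J lam φ :=
  phi4Flow_autocorr_ge_sticking_poly hlam J hq0 hqm hqi hq1 polyObs_magnetisation k

/-- **THE SUMMED STICKING FLOOR FOR EVERY POLYNOMIAL OBSERVABLE**: `f ∈ PolyObs`, `g = f − ⟨f⟩`, a
summable series ⇒ `τ_int(f) ≥ ½ + (∫ g² e^{−S} r/(1 − r) dφ)/(∫ g² e^{−S} dφ)`. -/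
theorem phi4Flow_tauInt_ge_stickingSummed_poly {lam : ℝ} (hlam : 0 < lam)
    (J : Fin (n + 1) → Fin (n + 1) → ℝ) {q : (Fin (n + 1) → ℝ) → ℝ} (hq0 : ∀ φ, 0 < q φ)
    (hqm : Measurable q) (hqi : Integrable q) (hq1 : ∫ φ, q φ = 1) {f : (Fin (n + 1) → ℝ) → ℝ}
    (hf : PolyObs f)
    (hs : Summable fun k => (∫ φ, (f φ - gibbsExpect J lam f)
        * ((imhOpPhi4 J lam q)^[k + 1] (fun ψ => f ψ - gibbsExpect J lam f)) φ * gibbsWeight J lam φ)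
        / ∫ φ, (f φ - gibbsExpect J lam f) ^ 2 * gibbsWeight J lam φ) :
    1 / 2 + (∫ φ, (f φ - gibbsExpect J lam f) ^ 2 * gibbsWeight J lam φ
        * ((∫ φ', (1 - imhAcceptQ (gibbsWeight J lam) q φ φ') * q φ')
          / (1 - ∫ φ', (1 - imhAcceptQ (gibbsWeight J lam) q φ φ') * q φ')))
        / ∫ φ, (f φ - gibbsExpect J lam f) ^ 2 * gibbsWeight J lam φ
      ≤ tauInt (fun k => (∫ φ, (f φ - gibbsExpect J lam f)
        * ((imhOpPhi4 J lam q)^[k] (fun ψ => f ψ - gibbsExpect J lam f)) φ * gibbsWeight J lam φ)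
        / ∫ φ, (f φ - gibbsExpect J lam f) ^ 2 * gibbsWeight J lam φ) := by
  obtain ⟨hgm, hg2⟩ := polyObs_sq_integrable hlam J (polyObs_sub_const hf (gibbsExpect J lam f))
  rw [imhOpPhi4_eq_imhOp] at hs ⊢
  exact imhOp_tauInt_ge_stickingSummed_of_sq (μ := volume) (fun φ => gibbsWeight_pos J lam φ)
    (continuous_gibbsWeight J lam).measurable (integrable_gibbsWeight hlam J) hq0 hqm hqi hq1 hgm hg2
    hs

/-- **THE MAGNETISATION'S SUMMED STICKING FLOOR**: a summable series for `M` under the flow arm forces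
`τ_int(M) ≥ ½ + E_{M̃²}[r/(1 − r)]/Var M` — every configuration contributes its `M̃²`-weight times
the expected number of consecutive rejections from it. -/
theorem phi4Flow_tauInt_ge_stickingSummed_magnetisation {lam : ℝ} (hlam : 0 < lam)
    (J : Fin (n + 1) → Fin (n + 1) → ℝ) {q : (Fin (n + 1) → ℝ) → ℝ} (hq0 : ∀ φ, 0 < q φ)
    (hqm : Measurable q) (hqi : Integrable q) (hq1 : ∫ φ, q φ = 1)
    (hs : Summable fun k => (∫ φ, ((∑ x, φ x) - gibbsExpect J lam (fun ψ => ∑ x, ψ x))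
        * ((imhOpPhi4 J lam q)^[k + 1]
            (fun ψ => (∑ x, ψ x) - gibbsExpect J lam (fun ψ => ∑ x, ψ x))) φ * gibbsWeight J lam φ)
        / ∫ φ, ((∑ x, φ x) - gibbsExpect J lam (fun ψ => ∑ x, ψ x)) ^ 2 * gibbsWeight J lam φ) :
    1 / 2 + (∫ φ, ((∑ x, φ x) - gibbsExpect J lam (fun ψ => ∑ x, ψ x)) ^ 2 * gibbsWeight J lam φ
        * ((∫ φ', (1 - imhAcceptQ (gibbsWeight J lam) q φ φ') * q φ')
          / (1 - ∫ φ', (1 - imhAcceptQ (gibbsWeight J lam) q φ φ') * q φ')))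
        / ∫ φ, ((∑ x, φ x) - gibbsExpect J lam (fun ψ => ∑ x, ψ x)) ^ 2 * gibbsWeight J lam φ
      ≤ tauInt (fun k => (∫ φ, ((∑ x, φ x) - gibbsExpect J lam (fun ψ => ∑ x, ψ x))
          * ((imhOpPhi4 J lam q)^[k]
              (fun ψ => (∑ x, ψ x) - gibbsExpect J lam (fun ψ => ∑ x, ψ x))) φ * gibbsWeight J lam φ)
          / ∫ φ, ((∑ x, φ x) - gibbsExpect J lam (fun ψ => ∑ x, ψ x)) ^ 2 * gibbsWeight J lam φ) :=
  phi4Flow_tauInt_ge_stickingSummed_poly hlam J hq0 hqm hqi hq1 polyObs_magnetisation hs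

end Lattice

end Summit.Ventures.LatticeQCDFlow.Exactness

/-! ## §3 A finite sticking column is NECESSARY for a summable series (GEN-22 append): for EVERY
square-integrable observable (no symmetry) summability under the exact flow sampler forces
`g² w r/(1 − r) ∈ L¹` (odd `g` + symmetric flow: an `iff`, `Phi4FlowSymmetricMagnetisationExact`). -/

namespace Summit.Ventures.LatticeQCDFlow.Exactness

open Real MeasureTheory Filter Finset Set Topology
open Summit.Ventures.LatticeQCDFlow.Scoring

/-- **`S_g < ∞` IS NECESSARY FOR SUMMABILITY.**  `w, q > 0` measurable integrable, `∫ q = 1`; `g`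
measurable, `∫ g² w < ∞`.  A summable normalised autocorrelation series of `g` forces
`g² w · r/(1 − r) ∈ L¹(μ)` with `∫ g² w r/(1 − r) ≤ (τ_int(g) − ½) ∫ g² w` (all-lag floors on the monotone
partial sums, + monotone convergence; bounded `g`: `IMHTauIntExact.integrable_layerCake_of_summable`). -/
theorem imhOp_integrable_stickingOdds_of_summable {X : Type*} [MeasurableSpace X] {μ : Measure X}
    [SFinite μ] {w q : X → ℝ} (hw0 : ∀ t, 0 < w t) (hwm : Measurable w) (hwi : Integrable w μ)
    (hq0 : ∀ t, 0 < q t) (hqm : Measurable q) (hqi : Integrable q μ) (hq1 : ∫ z, q z ∂μ = 1)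
    {g : X → ℝ} (hgm : Measurable g) (hg2 : Integrable (fun t => g t ^ 2 * w t) μ)
    (hs : Summable fun n => (∫ x, g x * ((imhOp μ w q)^[n + 1] g) x * w x ∂μ)
      / ∫ x, g x ^ 2 * w x ∂μ) :
    Integrable (fun x => g x ^ 2 * w x * ((∫ z, (1 - imhAcceptQ w q x z) * q z ∂μ)
        / (1 - ∫ z, (1 - imhAcceptQ w q x z) * q z ∂μ))) μ ∧
    ∫ x, g x ^ 2 * w x * ((∫ z, (1 - imhAcceptQ w q x z) * q z ∂μ)
        / (1 - ∫ z, (1 - imhAcceptQ w q x z) * q z ∂μ)) ∂μ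
      ≤ (tauInt (fun n => (∫ x, g x * ((imhOp μ w q)^[n] g) x * w x ∂μ) / ∫ x, g x ^ 2 * w x ∂μ)
          - 1 / 2) * ∫ x, g x ^ 2 * w x ∂μ := by
  obtain ⟨hr0, hr1, hrm⟩ := rejection_bounds (μ := μ) hw0 hwm hq0 hqm hqi hq1
  set r : X → ℝ := fun x => ∫ z, (1 - imhAcceptQ w q x z) * q z ∂μ with hr
  set A := ∫ x, g x ^ 2 * w x ∂μ with hA
  set τ := tauInt (fun n => (∫ x, g x * ((imhOp μ w q)^[n] g) x * w x ∂μ) / A) with hτ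
  have hA0 : 0 ≤ A := integral_nonneg fun x => mul_nonneg (sq_nonneg _) (hw0 x).le
  have hpart := imhOp_tauInt_ge_stickingSum_of_sq hw0 hwm hwi hq0 hqm hqi hq1 hgm hg2 hs
  have hgw0 : ∀ x, 0 ≤ g x ^ 2 * w x := fun x => mul_nonneg (sq_nonneg _) (hw0 x).le
  have hterm_le : ∀ n x, g x ^ 2 * w x * r x ^ (n + 1) ≤ g x ^ 2 * w x := fun n x =>
    mul_le_of_le_one_right (hgw0 x) (pow_le_one₀ (hr0 x) (hr1 x))
  have hterm_int : ∀ n, Integrable (fun x => g x ^ 2 * w x * r x ^ (n + 1)) μ := fun n => by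
    refine Integrable.mono' hg2 (((hgm.pow_const 2).mul hwm).mul
      (hrm.pow_const _)).aestronglyMeasurable (Eventually.of_forall fun x => ?_)
    rw [Real.norm_eq_abs, abs_of_nonneg (mul_nonneg (hgw0 x) (pow_nonneg (hr0 x) _))]
    exact hterm_le n x
  set f : ℕ → X → ℝ := fun N x => ∑ n ∈ Finset.range N, g x ^ 2 * w x * r x ^ (n + 1) with hf
  have hf0 : ∀ N, 0 ≤ᵐ[μ] f N := fun N => Eventually.of_forall fun x =>
    Finset.sum_nonneg fun n _ => mul_nonneg (hgw0 x) (pow_nonneg (hr0 x) _)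
  have hmono : ∀ᵐ x ∂μ, Monotone fun N => f N x := Eventually.of_forall fun x N N' hNN' =>
    Finset.sum_le_sum_of_subset_of_nonneg (Finset.range_mono hNN')
      fun n _ _ => mul_nonneg (hgw0 x) (pow_nonneg (hr0 x) _)
  have hlim : ∀ᵐ x ∂μ, Tendsto (fun N => f N x) atTop (𝓝 (g x ^ 2 * w x * (r x / (1 - r x)))) :=
    Eventually.of_forall fun x => by
      have hlt : r x < 1 := by
        show (∫ z, (1 - imhAcceptQ w q x z) * q z ∂μ) < 1
        rw [rejection_eq_rejCurve hw0 hq0 x]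
        exact rejCurve_lt_one hw0 hwm hq0 hqm hqi hq1 (div_pos (hw0 x) (hq0 x))
      have h := ((hasSum_geometric_of_lt_one (hr0 x) hlt).mul_left (r x)).mul_left (g x ^ 2 * w x)
      rw [← div_eq_mul_inv] at h
      exact (h.congr_fun fun k => by ring).tendsto_sum_nat
  have hle : ∀ N, ∫ x, f N x ∂μ ≤ (τ - 1 / 2) * A := fun N => by
    rw [integral_finsetSum _ fun n _ => hterm_int n]
    rcases eq_or_lt_of_le hA0 with hz | hpos
    · have h0 : ∀ n, ∫ x, g x ^ 2 * w x * r x ^ (n + 1) ∂μ = 0 := fun n =>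
        le_antisymm ((integral_mono (hterm_int n) hg2 fun x => hterm_le n x).trans hz.symm.le)
          (integral_nonneg fun x => mul_nonneg (hgw0 x) (pow_nonneg (hr0 x) _))
      simp only [h0, Finset.sum_const_zero, ← hz, mul_zero, le_refl]
    · have h' : ∑ n ∈ Finset.range N, (∫ x, g x ^ 2 * w x * r x ^ (n + 1) ∂μ) / A ≤ τ - 1 / 2 := by
        linarith [hpart N]
      rwa [← Finset.sum_div, div_le_iff₀ hpos] at h'
  exact integrable_of_monotone_integral_le (fun N => integrable_finsetSum _ fun n _ => hterm_int n)
    hf0 hmono hlim hle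

/-- **A SUMMABLE SERIES FOR THE MAGNETISATION FORCES `S_M < ∞`** (lattice φ⁴, every `λ > 0`, real
`J`, every positive model density, `∫ q̃ = 1`): summability of `M`'s series under the flow arm ⇒
`M̃² e^{−S} · r/(1 − r) ∈ L¹` — configurations from which the flow proposal is rejected with
probability near one carry summably little `M̃²`-mass, whatever the network (for a symmetric flow
also sufficient: `phi4Flow_magnetisation_summable_iff`). -/
theorem phi4Flow_integrable_stickingOdds_magnetisation_of_summable {n : ℕ} {lam : ℝ}
    (hlam : 0 < lam) (J : Fin (n + 1) → Fin (n + 1) → ℝ) {q : (Fin (n + 1) → ℝ) → ℝ}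
    (hq0 : ∀ φ, 0 < q φ) (hqm : Measurable q) (hqi : Integrable q) (hq1 : ∫ φ, q φ = 1)
    (hs : Summable fun k => (∫ φ, ((∑ x, φ x) - gibbsExpect J lam (fun ψ => ∑ x, ψ x))
        * ((imhOpPhi4 J lam q)^[k + 1]
            (fun ψ => (∑ x, ψ x) - gibbsExpect J lam (fun ψ => ∑ x, ψ x))) φ * gibbsWeight J lam φ)
        / ∫ φ, ((∑ x, φ x) - gibbsExpect J lam (fun ψ => ∑ x, ψ x)) ^ 2 * gibbsWeight J lam φ) :
    Integrable (fun φ : Fin (n + 1) → ℝ =>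
      ((∑ x, φ x) - gibbsExpect J lam (fun ψ => ∑ x, ψ x)) ^ 2 * gibbsWeight J lam φ
        * ((∫ φ', (1 - imhAcceptQ (gibbsWeight J lam) q φ φ') * q φ')
          / (1 - ∫ φ', (1 - imhAcceptQ (gibbsWeight J lam) q φ φ') * q φ'))) := by
  obtain ⟨hgm, hg2⟩ := polyObs_sq_integrable hlam J
    (polyObs_sub_const polyObs_magnetisation (gibbsExpect J lam (fun ψ => ∑ x, ψ x)))
  rw [imhOpPhi4_eq_imhOp] at hs
  exact (imhOp_integrable_stickingOdds_of_summable (μ := volume) (fun φ => gibbsWeight_pos J lam φ)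
    (continuous_gibbsWeight J lam).measurable (integrable_gibbsWeight hlam J) hq0 hqm hqi hq1 hgm hg2
    hs).1

end Summit.Ventures.LatticeQCDFlow.Exactness
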